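import Summits.AtomisticToContinuum.Crystallization.Theorems.FrustratedLawDichotomyBumpRadialCert
import Mathlib.Analysis.Convex.Function

/-!
# FrustratedLawDichotomy · the FAR FIELD of the radial domination certificate by CONVEXITY (Hermite–Hadamard) — a FINITE certificate for `SF₄₅` / `SF₅`

`…BumpRadialCert.schurFloor_of_radialCert` (hand-1 g13) reduces lens-5 g34's Schur floors to ONE continuous `κ ≥ 0` satisfying a one-variable
domination inequality for EVERY `r > 0` plus an `L¹` budget.  An interval-arithmetic certificate can only cover a COMPACT range of `r`; the
tail must be analytic.  Lens-5 (NODE-g34.md §3): «domination EXACT for `r ≥ R_b + 2a` by the spherical means of the subharmonic `r⁻⁶`».  THIS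
FILE proves the one-dimensional shadow of that remark and assembles the FINITE certificate:

* §1 `hermite_hadamard`: `φ` convex and continuous on `[r − τ, r + τ]` ⟹ `2τ·φ(r) ≤ ∫_{r−τ}^{r+τ} φ`;
* §2 `swap_triangle`: `∫_{s>0} s κ(s) ∫_{|r−s|}^{r+s} τ f(τ) dτ ds = ∫_{τ>0} τ f(τ) ∫_{|r−τ|}^{r+τ} s κ(s) ds dτ` (the triangle region is symmetric);
* §3 ★ `radialCert_far`: if `s ↦ s·κ(s)` is CONVEX on `[r − 2a, r + 2a]` (`r > 2a`) then the certificate functional at `r` is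
  `≥ (32πa³/105)²·κ(r)` (`(32πa³/105)² = ∫ β_a⋆β_a`; uses `∫_0^{2a} τ² omega₂(τ/a) dτ = (11/70)a³`, `integral_sq_omega₂`) — NB no sign
  condition on `κ` is needed here;
* §4 ★★ `schurFloor_of_radialCert_finite` and the literal ★ `sf₄₅_of_radialCert_finite` (`a = 4/5`, `A = 3/400`, `w = w₄₅`) /
  ★ `sf₅_of_radialCert_finite` (`a = 1`, `A = 13/4000`, `w = w₅`): NEAR FIELD `0 < r ≤ R₁` — the one-variable domination inequality (a compact
  range: interval arithmetic); FAR FIELD `r > R₁` (`R₁ > 2a`) — the POINTWISE inequality `−(V·w)(r) ≤ (32πa³/105)²·κ(r)` and convexity of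
  `s·κ(s)` on `[R₁ − 2a, ∞)` (for `κ ∝ |V|` beyond `R₁ − 2a`: `s·|V(s)| = s⁻⁵/6 − s⁻¹¹/12` is convex for `s⁶ ≥ 11/5`); plus the budget
  `4π(∫ s²κ)·a³·256π/3465 ≤ A`.

DEF-FREE; [folklore]; 0 sorry.  Prover hand 1, gen 13 (decomp-a2c), `--supports stmt-AtomisticToContinuum-27623`.
-/

noncomputable section

namespace Summit.AtomisticToContinuum.Crystallization.Theorems.FrustratedLawDichotomyBumpAutocorrelation

open MeasureTheory Set Real
open scoped BigOperators
open Summit.AtomisticToContinuum.Crystallization.Theorems.FrustratedLawDichotomySchurCut (omega₂ omega₂_zero omega₂_of_two_le)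

/-! ## §1. Hermite–Hadamard: the mean of a convex function over a symmetric interval dominates its central value -/

/-- **Hermite–Hadamard (left half)**: for `φ` convex and continuous on `[r − τ, r + τ]` (`τ ≥ 0`), `2τ·φ(r) ≤ ∫_{r−τ}^{r+τ} φ`. [folklore] -/
theorem hermite_hadamard {φ : ℝ → ℝ} {r τ : ℝ} (hτ : 0 ≤ τ) (hconv : ConvexOn ℝ (Icc (r - τ) (r + τ)) φ)
    (hcont : ContinuousOn φ (Icc (r - τ) (r + τ))) : 2 * τ * φ r ≤ ∫ s in (r - τ)..(r + τ), φ s := by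
  have hi1 : IntervalIntegrable φ volume (r - τ) r :=
    (hcont.mono (Icc_subset_Icc le_rfl (by linarith))).intervalIntegrable_of_Icc (by linarith)
  have hi2 : IntervalIntegrable φ volume r (r + τ) :=
    (hcont.mono (Icc_subset_Icc (by linarith) le_rfl)).intervalIntegrable_of_Icc (by linarith)
  rw [← intervalIntegral.integral_add_adjacent_intervals hi1 hi2]
  -- reflect the left piece
  have hL : ∫ s in (r - τ)..r, φ s = ∫ x in (0:ℝ)..τ, φ (r - x) := by
    rw [intervalIntegral.integral_comp_sub_left (fun s => φ s) r]
    simp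
  have hR : ∫ s in r..(r + τ), φ s = ∫ x in (0:ℝ)..τ, φ (r + x) := by
    rw [intervalIntegral.integral_comp_add_left (fun s => φ s) r]
    simp
  rw [hL, hR]
  have hcL : ContinuousOn (fun x => φ (r - x)) (Icc 0 τ) :=
    hcont.comp (by fun_prop) fun x hx => ⟨by linarith [hx.2], by linarith [hx.1]⟩
  have hcR : ContinuousOn (fun x => φ (r + x)) (Icc 0 τ) :=
    hcont.comp (by fun_prop) fun x hx => ⟨by linarith [hx.1], by linarith [hx.2]⟩
  rw [← intervalIntegral.integral_add (hcL.intervalIntegrable_of_Icc hτ) (hcR.intervalIntegrable_of_Icc hτ)]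
  have hconst : ∫ _ in (0:ℝ)..τ, 2 * φ r = 2 * τ * φ r := by simp; ring
  rw [← hconst]
  refine intervalIntegral.integral_mono_on hτ (by simp) ((hcL.intervalIntegrable_of_Icc hτ).add (hcR.intervalIntegrable_of_Icc hτ)) ?_
  intro x hx
  have hmem1 : r - x ∈ Icc (r - τ) (r + τ) := ⟨by linarith [hx.2], by linarith [hx.1]⟩
  have hmem2 : r + x ∈ Icc (r - τ) (r + τ) := ⟨by linarith [hx.1], by linarith [hx.2]⟩
  have h := hconv.2 hmem1 hmem2 (by norm_num : (0:ℝ) ≤ 1 / 2) (by norm_num : (0:ℝ) ≤ 1 / 2) (by norm_num)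
  simp only [smul_eq_mul] at h
  rw [show (1:ℝ) / 2 * (r - x) + 1 / 2 * (r + x) = r by ring] at h
  linarith

/-! ## §2. The second swap: over the triangle region `|r − s| < τ < r + s` the roles of `s` and `τ` are symmetric -/

/-- **Swap of the radial formula's two integrals** (`r > 0`; `κ`, `f` continuous, `f` vanishing on `[T, ∞)`, `T ≥ 0`):
`∫_{s>0} s κ(s) ∫_{|r−s|}^{r+s} τ f(τ) dτ ds = ∫_{τ>0} τ f(τ) ∫_{|r−τ|}^{r+τ} s κ(s) ds dτ`. [folklore] -/
theorem swap_triangle (κ f : ℝ → ℝ) (hκ : Continuous κ) (hf : Continuous f) {T : ℝ}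
    (hT : ∀ x, T ≤ x → f x = 0) {r : ℝ} (hr : 0 < r) :
    ∫ s in Ioi 0, s * κ s * ∫ τ in |r - s|..(r + s), τ * f τ =
      ∫ τ in Ioi 0, τ * f τ * ∫ s in |r - τ|..(r + τ), s * κ s := by
  set G : ℝ → ℝ → ℝ := fun s τ => s * κ s * (τ * f τ) with hG
  have hGc : Continuous (Function.uncurry G) := by
    rw [hG]
    exact (continuous_fst.mul (hκ.comp continuous_fst)).mul (continuous_snd.mul (hf.comp continuous_snd))
  set W : Set (ℝ × ℝ) := {p | 0 < p.1 ∧ |r - p.1| < p.2 ∧ p.2 < r + p.1} with hW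
  have hWo : IsOpen W := by
    refine (isOpen_lt continuous_const continuous_fst).inter ((isOpen_lt (by fun_prop) continuous_snd).inter
      (isOpen_lt continuous_snd (by fun_prop)))
  -- symmetry of the region
  have hWsymm : ∀ s τ : ℝ, (s, τ) ∈ W ↔ (0 < τ ∧ |r - τ| < s ∧ s < r + τ) := fun s τ => by
    show (0 < s ∧ |r - s| < τ ∧ τ < r + s) ↔ _
    constructor
    · rintro ⟨hs, h1, h2⟩
      rw [abs_lt] at h1
      refine ⟨by linarith [abs_nonneg (r - s), h1.1, h1.2], ?_, by linarith [h1.1]⟩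
      rw [abs_lt]; constructor <;> linarith [h1.2]
    · rintro ⟨hτ, h1, h2⟩
      rw [abs_lt] at h1
      refine ⟨by linarith [h1.1, h1.2], ?_, by linarith [h1.1]⟩
      rw [abs_lt]; constructor <;> linarith [h1.2]
  set F : ℝ × ℝ → ℝ := W.indicator (Function.uncurry G) with hF
  set B : Set (ℝ × ℝ) := Icc 0 (r + T) ×ˢ Icc 0 T with hB
  have hBc : IsCompact B := isCompact_Icc.prod isCompact_Icc
  have hFz : ∀ p, p ∉ B → F p = 0 := by
    rintro ⟨s, τ⟩ hp
    by_cases hu : ((s, τ) : ℝ × ℝ) ∈ W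
    · rw [hF, indicator_of_mem hu]
      obtain ⟨hs, h1, h2⟩ := hu
      have hτ0 : 0 < τ := (abs_nonneg _).trans_lt h1
      have hτT : T ≤ τ := by
        by_contra hlt
        push Not at hlt
        apply hp
        rw [abs_lt] at h1
        exact ⟨⟨hs.le, by linarith [h1.2]⟩, hτ0.le, hlt.le⟩
      simp [Function.uncurry, hG, hT _ hτT]
    · rw [hF, indicator_of_notMem hu]
  obtain ⟨M, hM⟩ := hBc.exists_bound_of_continuousOn hGc.continuousOn
  have hFint : Integrable F (volume.prod volume) := by
    have hg : Integrable (B.indicator fun _ => max M 0) (volume.prod volume) := by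
      rw [integrable_indicator_iff hBc.measurableSet]
      exact integrableOn_const hBc.measure_lt_top.ne
    refine hg.mono' ((hGc.aestronglyMeasurable).indicator hWo.measurableSet) (Filter.Eventually.of_forall fun p => ?_)
    by_cases hp : p ∈ B
    · rw [indicator_of_mem hp]
      by_cases hu : p ∈ W
      · rw [hF, indicator_of_mem hu]; exact (hM p hp).trans (le_max_left _ _)
      · rw [hF, indicator_of_notMem hu, norm_zero]; exact le_max_right _ _
    · rw [hFz p hp, norm_zero, indicator_of_notMem hp]
  -- the two iterated integrals of F
  have hL : ∀ s, (Ioi (0:ℝ)).indicator (fun s => s * κ s * ∫ τ in |r - s|..(r + s), τ * f τ) s = ∫ τ, F (s, τ) := fun s => by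
    by_cases hs : 0 < s
    · rw [indicator_of_mem (show s ∈ Ioi 0 from hs), ← intervalIntegral.integral_const_mul,
        intervalIntegral.integral_of_le (by rw [abs_le]; constructor <;> linarith : |r - s| ≤ r + s),
        integral_Ioc_eq_integral_Ioo, ← integral_indicator measurableSet_Ioo]
      refine integral_congr_ae (Filter.Eventually.of_forall fun τ => ?_)
      show (Ioo |r - s| (r + s)).indicator (fun τ => s * κ s * (τ * f τ)) τ = W.indicator (Function.uncurry G) (s, τ)
      by_cases h : τ ∈ Ioo |r - s| (r + s)
      · rw [indicator_of_mem h, indicator_of_mem (show (s, τ) ∈ W from ⟨hs, h.1, h.2⟩)]; rfl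
      · rw [indicator_of_notMem h, indicator_of_notMem (show (s, τ) ∉ W from fun h' => h ⟨h'.2.1, h'.2.2⟩)]
    · rw [indicator_of_notMem (show s ∉ Ioi 0 from hs)]
      have : ∀ τ, F (s, τ) = 0 := fun τ => by
        rw [hF, indicator_of_notMem]
        exact fun h' => hs h'.1
      simp [this]
  have hR : ∀ τ, (Ioi (0:ℝ)).indicator (fun τ => τ * f τ * ∫ s in |r - τ|..(r + τ), s * κ s) τ = ∫ s, F (s, τ) := fun τ => by
    by_cases hτ : 0 < τ
    · rw [indicator_of_mem (show τ ∈ Ioi 0 from hτ), ← intervalIntegral.integral_const_mul,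
        intervalIntegral.integral_of_le (by rw [abs_le]; constructor <;> linarith : |r - τ| ≤ r + τ),
        integral_Ioc_eq_integral_Ioo, ← integral_indicator measurableSet_Ioo]
      refine integral_congr_ae (Filter.Eventually.of_forall fun s => ?_)
      show (Ioo |r - τ| (r + τ)).indicator (fun s => τ * f τ * (s * κ s)) s = W.indicator (Function.uncurry G) (s, τ)
      by_cases h : s ∈ Ioo |r - τ| (r + τ)
      · rw [indicator_of_mem h, indicator_of_mem (show (s, τ) ∈ W from (hWsymm s τ).mpr ⟨hτ, h.1, h.2⟩)]
        simp [Function.uncurry, hG]; ring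
      · rw [indicator_of_notMem h, indicator_of_notMem (show (s, τ) ∉ W from fun h' =>
          h ⟨((hWsymm s τ).mp h').2.1, ((hWsymm s τ).mp h').2.2⟩)]
    · rw [indicator_of_notMem (show τ ∉ Ioi 0 from hτ)]
      have : ∀ s, F (s, τ) = 0 := fun s => by
        rw [hF, indicator_of_notMem]
        exact fun h' => hτ ((hWsymm s τ).mp h').1
      simp [this]
  calc ∫ s in Ioi 0, s * κ s * ∫ τ in |r - s|..(r + s), τ * f τ
      = ∫ s, (Ioi (0:ℝ)).indicator (fun s => s * κ s * ∫ τ in |r - s|..(r + s), τ * f τ) s := (integral_indicator measurableSet_Ioi).symm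
    _ = ∫ s, ∫ τ, F (s, τ) := by simp only [hL]
    _ = ∫ τ, ∫ s, F (s, τ) := by
        have e : (Function.uncurry fun s τ => F (s, τ)) = F := by funext ⟨s, τ⟩; rfl
        exact integral_integral_swap (e ▸ hFint)
    _ = ∫ τ, (Ioi (0:ℝ)).indicator (fun τ => τ * f τ * ∫ s in |r - τ|..(r + τ), s * κ s) τ := by simp only [hR]
    _ = ∫ τ in Ioi 0, τ * f τ * ∫ s in |r - τ|..(r + τ), s * κ s := integral_indicator measurableSet_Ioi

/-! ## §3. The far-field criterion -/

/-- `∫_0^{2a} τ² omega₂(τ/a) dτ = (11/70)·a³`. [folklore] -/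
theorem integral_sq_omega₂ {a : ℝ} (ha : 0 < a) : ∫ τ in (0:ℝ)..(2 * a), τ ^ 2 * omega₂ (τ / a) = 11 / 70 * a ^ 3 := by
  have hle : (0:ℝ) ≤ 2 * a := by positivity
  set c : ℕ → ℝ := fun k => if k = 2 then 1 else if k = 4 then -(11 / 6) / a ^ 2 else if k = 6 then 33 / 16 / a ^ 4
    else if k = 7 then -(77 / 64) / a ^ 5 else if k = 9 then 33 / 256 / a ^ 7 else if k = 11 then -(11 / 1024) / a ^ 9
    else if k = 13 then 5 / 12288 / a ^ 11 else 0 with hc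
  have heq : ∀ τ ∈ Ioo (0:ℝ) (2 * a), τ ^ 2 * omega₂ (τ / a) = ∑ k ∈ Finset.range 14, c k * τ ^ k := by
    intro τ hτ
    have hlt : τ / a < 2 := by rw [div_lt_iff₀ ha]; linarith [hτ.2]
    rw [omega₂, if_pos hlt]
    simp [Finset.sum_range_succ, hc]
    field_simp
    ring
  rw [intervalIntegral.integral_congr_ae (g := fun τ => ∑ k ∈ Finset.range 14, c k * τ ^ k) ?_]
  · rw [integral_poly]
    simp [Finset.sum_range_succ, hc]
    field_simp
    ring
  · rw [uIoc_of_le hle]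
    refine Filter.Eventually.of_forall fun τ hτ => ?_
    rcases hτ.2.eq_or_lt with h | h
    · rw [h, omega₂_of_two_le (by field_simp; norm_num)]
      simp [Finset.sum_range_succ, hc]
      field_simp
      ring
    · exact heq τ ⟨hτ.1, h⟩

/-- ★ **THE FAR-FIELD CRITERION (convexity / Hermite–Hadamard, the one-dimensional shadow of subharmonicity)**: if `κ ≥ 0` is continuous and
`s ↦ s·κ(s)` is CONVEX on `[r − 2a, r + 2a]` with `r > 2a`, then the radial certificate functional at `r` is at least `(32πa³/105)²·κ(r)`:
`(32πa³/105)²·κ(r) ≤ a³·(512π/3465)·(2π/r)·∫_{s>0} s κ(s) ∫_{|r−s|}^{r+s} τ·omega₂(τ/a) dτ ds` (`(32πa³/105)² = ∫(β_a⋆β_a)`).  So beyond any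
`R₁ > 2a` the domination inequality follows from the POINTWISE inequality `−(V·w)(r) ≤ (32πa³/105)²·κ(r)` once `s·κ(s)` is convex on
`[R₁ − 2a, ∞)`. [folklore] -/
theorem radialCert_far {a : ℝ} (ha : 0 < a) (κ : ℝ → ℝ) (hκc : Continuous κ) {r : ℝ} (hr : 2 * a < r)
    (hconv : ConvexOn ℝ (Icc (r - 2 * a) (r + 2 * a)) (fun s => s * κ s)) :
    (32 * π * a ^ 3 / 105) ^ 2 * κ r ≤
      a ^ 3 * (512 * π / 3465) * (2 * π / r * ∫ s in Ioi 0, s * κ s * ∫ τ in |r - s|..(r + s), τ * omega₂ (τ / a)) := by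
  have hr0 : 0 < r := by linarith
  have h2a : (0:ℝ) ≤ 2 * a := by positivity
  have hf : Continuous fun τ : ℝ => omega₂ (τ / a) := continuous_omega₂.comp (continuous_id.div_const a)
  have hT : ∀ x : ℝ, 2 * a ≤ x → omega₂ (x / a) = 0 := fun x hx => omega₂_of_two_le (by rwa [le_div_iff₀ ha])
  rw [swap_triangle κ (fun τ => omega₂ (τ / a)) hκc hf hT hr0]
  -- the τ-integrand and its minorant
  set Φ : ℝ → ℝ := fun τ => ∫ s in |r - τ|..(r + τ), s * κ s with hΦ
  have hsk : Continuous fun s : ℝ => s * κ s := continuous_id.mul hκc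
  have hP : Continuous fun x : ℝ => ∫ s in (0:ℝ)..x, s * κ s :=
    intervalIntegral.continuous_primitive (fun a b => hsk.intervalIntegrable a b) 0
  have hΦ' : Φ = fun τ => (∫ s in (0:ℝ)..(r + τ), s * κ s) - ∫ s in (0:ℝ)..|r - τ|, s * κ s := by
    funext τ
    rw [hΦ, intervalIntegral.integral_interval_sub_left (hsk.intervalIntegrable _ _) (hsk.intervalIntegrable _ _)]
  have hΦc : Continuous Φ := by
    rw [hΦ']
    exact (hP.comp (by fun_prop)).sub (hP.comp (continuous_abs.comp (by fun_prop)))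
  set h : ℝ → ℝ := fun τ => τ * omega₂ (τ / a) * Φ τ with hh
  set g : ℝ → ℝ := fun τ => τ * omega₂ (τ / a) * (2 * τ * (r * κ r)) with hg
  have hhc : Continuous h := by rw [hh]; exact (continuous_id.mul hf).mul hΦc
  have hgc : Continuous g := by rw [hg]; fun_prop
  -- restrict the τ-integral to (0, 2a]
  have hX : ∫ τ in Ioi 0, τ * omega₂ (τ / a) * Φ τ = ∫ τ in (0:ℝ)..(2 * a), h τ := by
    rw [intervalIntegral.integral_of_le h2a]
    refine setIntegral_eq_of_subset_of_forall_sdiff_eq_zero measurableSet_Ioi (Ioc_subset_Ioi_self : Ioc (0:ℝ) (2 * a) ⊆ Ioi 0) ?_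
    intro τ hτ
    have hτ' : 2 * a ≤ τ := by
      rcases hτ with ⟨h1, h2⟩
      simp only [mem_Ioc, not_and, not_le] at h2
      exact (h2 h1).le
    simp [hT _ hτ']
  -- Hermite–Hadamard pointwise
  have hmono : ∫ τ in (0:ℝ)..(2 * a), g τ ≤ ∫ τ in (0:ℝ)..(2 * a), h τ := by
    refine intervalIntegral.integral_mono_on h2a (hgc.intervalIntegrable _ _) (hhc.intervalIntegrable _ _) fun τ hτ => ?_
    have hτ0 : 0 ≤ τ := hτ.1
    have hω : 0 ≤ τ * omega₂ (τ / a) := mul_nonneg hτ0 (omega₂_nonneg (by positivity))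
    have hHH : 2 * τ * (r * κ r) ≤ Φ τ := by
      have hsub : Icc (r - τ) (r + τ) ⊆ Icc (r - 2 * a) (r + 2 * a) := Icc_subset_Icc (by linarith [hτ.2]) (by linarith [hτ.2])
      have := hermite_hadamard hτ0 (hconv.subset hsub (convex_Icc _ _)) (hsk.continuousOn)
      show 2 * τ * (r * κ r) ≤ ∫ s in |r - τ|..(r + τ), s * κ s
      rwa [show |r - τ| = r - τ from abs_of_nonneg (by linarith [hτ.2])]
    rw [hg, hh]
    exact mul_le_mul_of_nonneg_left hHH hω
  have hgval : ∫ τ in (0:ℝ)..(2 * a), g τ = 2 * r * κ r * (11 / 70 * a ^ 3) := by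
    rw [← integral_sq_omega₂ ha, ← intervalIntegral.integral_const_mul]
    refine intervalIntegral.integral_congr fun τ _ => ?_
    simp only [hg]; ring
  have hXge : 2 * r * κ r * (11 / 70 * a ^ 3) ≤ ∫ τ in Ioi 0, τ * omega₂ (τ / a) * Φ τ := by
    rw [hX, ← hgval]; exact hmono
  have hc0 : 0 ≤ a ^ 3 * (512 * π / 3465) * (2 * π / r) := by positivity
  calc (32 * π * a ^ 3 / 105) ^ 2 * κ r = a ^ 3 * (512 * π / 3465) * (2 * π / r) * (2 * r * κ r * (11 / 70 * a ^ 3)) := by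
        field_simp; ring
    _ ≤ a ^ 3 * (512 * π / 3465) * (2 * π / r) * ∫ τ in Ioi 0, τ * omega₂ (τ / a) * Φ τ := mul_le_mul_of_nonneg_left hXge hc0
    _ = _ := by rw [hΦ]; ring

/-! ## §4. The FINITE certificate: near field on a compact range, far field pointwise -/

open Summit.AtomisticToContinuum.Crystallization.Theorems.FrustratedLawDichotomySchurCut (SchurFloor tailPot SF₄₅ SF₅ w₄₅ w₅ ω₄ ω₅ w₅_eq_zero)

/-- ★★ **SCHUR FLOOR FROM A FINITE ONE-VARIABLE CERTIFICATE**: near field (`0 < r ≤ R₁`) the radial domination inequality, far field (`r > R₁`,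
`R₁ > 2a`) the POINTWISE inequality `−(V·w)(r) ≤ (32πa³/105)²·κ(r)` together with convexity of `s·κ(s)` on `[R₁ − 2a, ∞)`; plus the `L¹`
budget.  Conclusion `SchurFloor w (omega₂(·/a)) A`. [folklore chaining] -/
theorem schurFloor_of_radialCert_finite {a : ℝ} (ha : 0 < a) (w : ℝ → ℝ) (hw0 : w 0 = 0) (κ : ℝ → ℝ) (hκc : Continuous κ)
    (hκ0 : ∀ s, 0 ≤ κ s) (hκi : IntegrableOn (fun s => s ^ 2 * κ s) (Ioi 0)) (R₁ : ℝ) (hR₁ : 2 * a < R₁)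
    (hnear : ∀ r, 0 < r → r ≤ R₁ → -(tailPot w r) ≤
      a ^ 3 * (512 * π / 3465) * (2 * π / r * ∫ s in Ioi 0, s * κ s * ∫ τ in |r - s|..(r + s), τ * omega₂ (τ / a)))
    (hfar : ∀ r, R₁ < r → -(tailPot w r) ≤ (32 * π * a ^ 3 / 105) ^ 2 * κ r)
    (hconv : ConvexOn ℝ (Ici (R₁ - 2 * a)) (fun s => s * κ s))
    {A : ℝ} (hA : 4 * π * (∫ s in Ioi 0, s ^ 2 * κ s) * (a ^ 3 * (256 * π / 3465)) ≤ A) :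
    SchurFloor w (fun r => omega₂ (r / a)) A := by
  refine schurFloor_of_radialCert ha w hw0 κ hκc hκ0 hκi (fun r hr => ?_) hA
  rcases le_or_gt r R₁ with h | h
  · exact hnear r hr h
  · refine (hfar r h).trans (radialCert_far ha κ hκc (hR₁.trans h) (hconv.subset ?_ (convex_Icc _ _)))
    exact fun s hs => show R₁ - 2 * a ≤ s by linarith [hs.1]

/-- ★ **`SF₄₅` from a finite one-variable certificate** (`a = 4/5`, window `8/5`, `A = 3/400`, `w = w₄₅`; far-field constant
`(32π(4/5)³/105)² = (2048π/13125)²`). [folklore chaining] -/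
theorem sf₄₅_of_radialCert_finite (κ : ℝ → ℝ) (hκc : Continuous κ) (hκ0 : ∀ s, 0 ≤ κ s) (hκi : IntegrableOn (fun s => s ^ 2 * κ s) (Ioi 0))
    (R₁ : ℝ) (hR₁ : 8 / 5 < R₁)
    (hnear : ∀ r, 0 < r → r ≤ R₁ → -(tailPot w₄₅ r) ≤
      (4 / 5 : ℝ) ^ 3 * (512 * π / 3465) * (2 * π / r * ∫ s in Ioi 0, s * κ s * ∫ τ in |r - s|..(r + s), τ * omega₂ (τ / (4 / 5))))
    (hfar : ∀ r, R₁ < r → -(tailPot w₄₅ r) ≤ (32 * π * (4 / 5 : ℝ) ^ 3 / 105) ^ 2 * κ r)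
    (hconv : ConvexOn ℝ (Ici (R₁ - 8 / 5)) (fun s => s * κ s))
    (hA : 4 * π * (∫ s in Ioi 0, s ^ 2 * κ s) * ((4 / 5 : ℝ) ^ 3 * (256 * π / 3465)) ≤ 3 / 400) : SF₄₅ := by
  have hω : (fun r => omega₂ (r / (4 / 5))) = ω₄ := by funext r; simp only [ω₄]; congr 1; ring
  have h := schurFloor_of_radialCert_finite (by norm_num : (0:ℝ) < 4 / 5) w₄₅ w₄₅_zero κ hκc hκ0 hκi R₁ (by linarith) hnear hfar
    (by rwa [show R₁ - 2 * (4 / 5 : ℝ) = R₁ - 8 / 5 by ring]) hA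
  rw [hω] at h
  exact h

/-- ★ **`SF₅` from a finite one-variable certificate** (`a = 1`, window `2`, `A = 13/4000`, `w = w₅`; far-field constant `(32π/105)²`).
[folklore chaining] -/
theorem sf₅_of_radialCert_finite (κ : ℝ → ℝ) (hκc : Continuous κ) (hκ0 : ∀ s, 0 ≤ κ s) (hκi : IntegrableOn (fun s => s ^ 2 * κ s) (Ioi 0))
    (R₁ : ℝ) (hR₁ : 2 < R₁)
    (hnear : ∀ r, 0 < r → r ≤ R₁ → -(tailPot w₅ r) ≤
      512 * π / 3465 * (2 * π / r * ∫ s in Ioi 0, s * κ s * ∫ τ in |r - s|..(r + s), τ * omega₂ τ))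
    (hfar : ∀ r, R₁ < r → -(tailPot w₅ r) ≤ (32 * π / 105) ^ 2 * κ r)
    (hconv : ConvexOn ℝ (Ici (R₁ - 2)) (fun s => s * κ s))
    (hA : 4 * π * (∫ s in Ioi 0, s ^ 2 * κ s) * (256 * π / 3465) ≤ 13 / 4000) : SF₅ := by
  have hω : (fun r => omega₂ (r / 1)) = ω₅ := by funext r; simp [ω₅]
  have h := schurFloor_of_radialCert_finite one_pos w₅ (w₅_eq_zero (by norm_num)) κ hκc hκ0 hκi R₁ (by linarith)
    (fun r hr hle => by simpa using hnear r hr hle) (fun r hr => by simpa using hfar r hr)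
    (by rwa [show R₁ - 2 * (1 : ℝ) = R₁ - 2 by ring]) (A := 13 / 4000) (by simpa using hA)
  rw [hω] at h
  exact h

end Summit.AtomisticToContinuum.Crystallization.Theorems.FrustratedLawDichotomyBumpAutocorrelation

end
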